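import Summits.ABC.StewartYu.PadicG3HalfDescent
import HarnessLib

/-!
# Cell abc-stewartyu, crux `Y07Odd` (stmt-ABC-19658), line `gen3-slab-odd`: the Kummer half-step, part 5 — GLUE: a vanishing parity class sum
# at the half point `s/2` is the vanishing `g3φ R′ v′ B_κ w τ s = 0` of the RE-INDEXED family at the odd integer `s`

`Summits/ABC/StewartYu/PadicG3HalfStep.lean` — sequel to `PadicG3HalfDescent` (cell `abc-stewartyu`, design HOME/p2/HALFSTEP-ODD.md; seat p2-g4, F-odd
lead).  Definitions (`parityClass`, `halfVec`) and theorems on `G3Setup`; no named fact.  Nesterenko's step `(s, n) → (s+1, 0)` for the generic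
class family: on the parity class `B_κ = {i ∈ B : vᵢ ≡ κ₀ (mod 2)}` put `vᵢ = κ₀ + 2·vᵢ′` (`halfVec`); if, for a fixed odd `s` and `t₀`, the
class sums of part 3 vanish for all directional orders `|t| ≤ U`,
`Σ_{i∈B_κ} wᵢ · (Hasse_{t₀}Rᵢ)(s/2) · zγpow(vᵢ)(t) · qEhG α (rootExp L vᵢ s) = 0`,
and the `Y₀`-polynomials of the next level satisfy `(Hasse_{t₀}Rᵢ)(s/2) = c · (Hasse_{t₀}Rᵢ′)(s)` with `c ≠ 0` (for `Rᵢ′ = Rᵢ ∘ (Y/2)`: `c = 2^{t₀}`),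
then `g3φ R′ v′ B_κ w (t₀, t) s = 0` for all `|t| ≤ U` (`qEhG_rootExp_of_class` + `descent_dirMoments`).

WHAT THIS IS NOT: no analysis (the smallness ⇒ class sums = 0 is part 3); no parameters; no crux moves.

References: Yu. V. Nesterenko, LNM 1819 (2003) §4.3; K. Yu, Compositio 74 (1990) (2.101)–(2.106).
-/

noncomputable section

open Finset Polynomial
open Literature.NumberTheory.Transcendental
open Literature.NumberTheory.Transcendental.CW77.Setup (Tau tauNorm)
open scoped Nat

namespace Summit.ABC.StewartYu

namespace G3Setup

variable {p : ℕ} [Fact p.Prime] (S : G3Setup p) {ι : Type*} (R R' : ι → ℚ[X]) (v : ι → Fin S.n → ℤ)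

/-! ### The parity class and the halved exponents -/

/-- The parity class of `κ₀` inside `B`: the indices with `vᵢⱼ ≡ κ₀ⱼ (mod 2)` for all `j`. [cite: Nesterenko2003, §4.3] -/
def parityClass (B : Finset ι) (κ₀ : Fin S.n → ℤ) : Finset ι :=
  B.filter fun i => ∀ j, 2 ∣ v i j - κ₀ j

/-- `parityClass ⊆ B`. [folklore] -/
theorem parityClass_subset (B : Finset ι) (κ₀ : Fin S.n → ℤ) : S.parityClass v B κ₀ ⊆ B := filter_subset _ _

/-- The halved exponents `vᵢ′ = (vᵢ − κ₀)/2`. [cite: Nesterenko2003, §4.3] -/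
def halfVec (κ₀ : Fin S.n → ℤ) (i : ι) : Fin S.n → ℤ := fun j => (v i j - κ₀ j) / 2

/-- On the parity class, `vᵢ = κ₀ + 2·vᵢ′`. [folklore] -/
theorem eq_add_two_smul_halfVec {B : Finset ι} {κ₀ : Fin S.n → ℤ} {i : ι} (hi : i ∈ S.parityClass v B κ₀) :
    v i = κ₀ + (2 : ℤ) • S.halfVec v κ₀ i := by
  funext j
  have hd : 2 ∣ v i j - κ₀ j := (mem_filter.mp hi).2 j
  simp only [halfVec, Pi.add_apply, Pi.smul_apply, smul_eq_mul]
  rw [Int.mul_ediv_cancel' hd]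
  ring

/-- The halved exponents stay in the halved box: `|vᵢⱼ| ≤ L_j`, `κ₀ⱼ ∈ {0,1}` ⇒ `|vᵢⱼ′| ≤ (L_j + 1)/2`. [folklore] -/
theorem abs_halfVec_le {B : Finset ι} {κ₀ : Fin S.n → ℤ} (hκ : ∀ j, κ₀ j = 0 ∨ κ₀ j = 1) {L : Fin S.n → ℕ}
    {i : ι} (hi : i ∈ S.parityClass v B κ₀) (hL : ∀ j, |v i j| ≤ (L j : ℤ)) (j : Fin S.n) :
    |S.halfVec v κ₀ i j| ≤ (((L j + 1) / 2 : ℕ) : ℤ) := by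
  have hd : 2 ∣ v i j - κ₀ j := (mem_filter.mp hi).2 j
  obtain ⟨c, hc⟩ := hd
  have hv : S.halfVec v κ₀ i j = c := by
    simp only [halfVec]; rw [hc, Int.mul_ediv_cancel_left _ two_ne_zero]
  rw [hv]
  have h1 := hL j
  rw [abs_le] at h1 ⊢
  push_cast
  rcases hκ j with h0 | h0 <;> rw [h0] at hc <;> constructor <;> omega

/-! ### The glue -/

/-- **The half-step glue.** Fix an odd `s`, `t₀`, the parity class `B_κ` of `κ₀ ∈ {0,1}ⁿ` (box `|vᵢⱼ| ≤ L_j` on it), weights `w`, and next-level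
`Y₀`-polynomials with `(Hasse_{t₀}Rᵢ)(s/2) = c·(Hasse_{t₀}Rᵢ′)(s)`, `c ≠ 0`.  If the class sums vanish for all `|t| ≤ U`,
`Σ_{i∈B_κ} wᵢ (Hasse_{t₀}Rᵢ)(s/2) · zγpow(vᵢ)(t) · qEhG α (rootExp L vᵢ s) = 0`, then `g3φ R′ v′ B_κ w (t₀, t) s = 0` for all `|t| ≤ U`.
[cite: Nesterenko2003, §4.3] [cite: Yu1990, (2.101)–(2.106)] -/
theorem g3φ_halfStep (B : Finset ι) {κ₀ : Fin S.n → ℤ} (hκ : ∀ j, κ₀ j = 0 ∨ κ₀ j = 1) {L : Fin S.n → ℕ}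
    (hL : ∀ i ∈ S.parityClass v B κ₀, ∀ j, |v i j| ≤ (L j : ℤ)) (w : ι → ℤ) {s : ℤ} (hs : Odd s) (t₀ U : ℕ)
    {c : ℚ} (hc : c ≠ 0) (hRR' : ∀ i ∈ S.parityClass v B κ₀, (hasseDeriv t₀ (R i)).eval ((s : ℚ) / 2) = c * (hasseDeriv t₀ (R' i)).eval (s : ℚ))
    (hzero : ∀ t : Fin S.n → ℕ, ∑ k, t k ≤ U →
      ∑ i ∈ S.parityClass v B κ₀, (w i : ℚ) * (((hasseDeriv t₀ (R i)).eval ((s : ℚ) / 2) * S.zγpow v i t) *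
        HalfMono.qEhG S.α (S.rootExp L (v i) s)) = 0) :
    ∀ t : Fin S.n → ℕ, ∑ k, t k ≤ U → S.g3φ R' (S.halfVec v κ₀) (S.parityClass v B κ₀) w (t₀, t) s = 0 := by
  classical
  set Bκ := S.parityClass v B κ₀ with hBκ
  set v' := S.halfVec v κ₀ with hv'
  -- the common nonzero factor `K(s) = ∏ⱼ αⱼ^{L_j|s| + κ₀ⱼ(s−1)/2}`
  set K : ℚ := ∏ j, S.α j ^ ((L j : ℤ) * |s| + κ₀ j * ((s - 1) / 2)) with hK
  have hK0 : K ≠ 0 := prod_ne_zero_iff.mpr fun j _ => zpow_ne_zero _ (S.α_ne j)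
  -- the `t`-independent weights of the new family
  set W : ι → ℚ := fun i => (w i : ℚ) * (hasseDeriv t₀ (R' i)).eval (s : ℚ) * ∏ j, S.α j ^ (v' i j * s) with hW
  -- Step 1: the class identity is `c·K · Σ W_i zγpow(v_i)(t) = 0`
  have hold : ∀ t : Fin S.n → ℕ, ∑ k, t k ≤ U → ∑ i ∈ Bκ, W i * ∏ k, S.zγ (v i) k ^ t k = 0 := by
    intro t ht
    have h := hzero t ht
    have hre : ∑ i ∈ Bκ, (w i : ℚ) * (((hasseDeriv t₀ (R i)).eval ((s : ℚ) / 2) * S.zγpow v i t) *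
        HalfMono.qEhG S.α (S.rootExp L (v i) s)) = (c * K) * ∑ i ∈ Bκ, W i * ∏ k, S.zγ (v i) k ^ t k := by
      rw [mul_sum]
      refine sum_congr rfl fun i hi => ?_
      rw [hRR' i hi, S.qEhG_rootExp_of_class κ₀ (hL i hi) hκ (S.eq_add_two_smul_halfVec v hi) hs]
      simp only [hW, zγpow, hK]
      ring
    rw [hre] at h
    rcases mul_eq_zero.mp h with h1 | h1
    · exact absurd h1 (mul_ne_zero hc hK0)
    · exact h1
  -- Step 2: triangular descent to the halved exponents
  have hnew := S.descent_dirMoments v v' κ₀ Bκ (fun i hi => S.eq_add_two_smul_halfVec v hi) W U hold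
  -- Step 3: this is `g3φ R′ v′ B_κ w (t₀, t) s`
  intro t ht
  have h := hnew t ht
  unfold g3φ
  rw [← h]
  refine sum_congr rfl fun i _ => ?_
  simp only [hW, zγpow]
  ring

end G3Setup

end Summit.ABC.StewartYu

end
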